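import Literature.AnabelianGeometry.SemiGraphs.ArithTemperedGroupOfOuterAction
import Literature.AnabelianGeometry.SemiGraphs.ArithDecompositionData
import Literature.AnabelianGeometry.SemiGraphs.ArithMaximalCompact
import Literature.AnabelianGeometry.SemiGraphs.Prop36HypothesesWitnessAffChart
import HarnessLib

/-!
# [SemiAnbd] Thm 5.4 (i) p. 66 — NON-VACUITY of the T54-B capstone's DESIGN inputs `hV`, `hE`, `hopen`,
# `noSwitchBase`, `hest`, `hbot` at the trivial outer action over the tree's Thm-3.7 witnesses (proof-only)

Mochizuki, *Semi-graphs of anabelioids*, Publ. RIMS **42** (2006), §5 Def 5.1 (i) p. 62, Def 5.3 p. 65,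
Thm 5.4 p. 66 [cite: MochizukiSemiAnbd2006, Thm 5.4 (i) p.66]; Prop 3.6 / Thm 3.7 pp. 38–41.

PROOF-ONLY file (cell abc-iut, layer L3, sub-DAG `plan/L3/SUBDAG-SemiAnbd-Thm54.md`, row «NV-L3 T54 capstone
inputs», L3-lead ruling α54 (b), seat abc-iut-w6-d099; no definition, no instance, no new named fact).

abc-iut-w4-d029's capstone `arithMaximalCompactStatementI_outerAction_piPresentation` (staged
`ArithThm54iCapstoneOuterAction.lean`) proves the typed Thm 5.4 (i) at `E := π₁^temp(𝒢) ⋊^out Π_A` modulo named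
binders.  Among them the DESIGN inputs (print's own frame of Def 5.1 (i) / Thm 5.4):
* `hV` / `hE` — Prop 3.6 (iv) at `ρ_𝔾(a)`: some representative of the outer class `ρ a` carries verticial
  (edge-like) subgroups at `v` (`e`) to verticial (edge-like) subgroups at `a • v` (`a • e`)
  (abc-iut-w4-d082 `arithChartAction_outerAction`, abc-iut-w4-d040 `arithChartBranchAction_outerAction`);
* `hopen` — Def 5.1 (i)(c): an open subgroup of `Π_A` acts trivially on the underlying semi-graph;
* `noSwitchBase` — Thm 5.4's «the arithmetic actions … do not switch the branches of any edge»;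
* `hest` — Def 5.3 (ii): `𝔊` totally arithmetically estranged (`IsTotallyArithEstranged` of the produced
  decomposition data `decompositionDataOfChart R ι`);
* `hbot` — `⊥` is not arithmetically ample (`Π_A` is not discrete).

THIS FILE: (§1, generic) for ANY semi-graph of anabelioids `𝒢`, chart `c` and topological group `Π_A` acting
through the TRIVIAL outer action `ρ := 1 : Π_A →* Out(π₁^temp 𝒢)` and trivially on the underlying semi-graph
(`baseAct := 1`) — i.e. `E ≅ π₁^temp(𝒢) × Π_A`, the direct-product shape of the cell's `G_{ℚ_p} × F̂₂` /
`Aff(ℤ_p)` toys — `hV`, `hE`, `hopen`, `noSwitchBase` hold (representative `φ := 1`, open subgroup `⊤`); `hest`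
holds VACUOUSLY whenever `𝒢` has no edge; `hbot`
holds as soon as `{1}` is not open in `Π_A` (e.g. `Aff(ℤ_p)`: every neighbourhood of `1` contains a congruence
subgroup `Γ_n ∋ (pⁿ, 1) ≠ 1`).  (§2, instance) at the tree's Thm-3.7 witness `affWitness p` (one vertex with anabelioid `B(Aff(ℤ_p))`,
no edge; abc-iut-w5-d212 / w5-d236, chart `affChart p` with `π₁^temp = Aff(ℤ_p)` on the nose) and
`Π_A := Aff(ℤ_p)`: all six inputs are inhabited SIMULTANEOUSLY, together with `Thm37Hypotheses`, `IsGraph` and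
finiteness of vertices/branches (`capstoneDesignInputs_affWitness`).

HONEST FINDING (the point of the exercise): every Thm-3.7 witness the tree has is EDGELESS, so the EDGE-indexed
inputs `hE`, `noSwitchBase`, `hest` are inhabited only vacuously here; `hV`, `hopen`, `hbot` carry content.  A
CONTENTFUL non-vacuity certificate for `hest` / `noSwitchBase` needs a semi-graph of anabelioids WITH AN EDGE
satisfying `Thm37Hypotheses` (aloof + estranged + elevated + quasi-coherent with a non-trivial edge group),
which no tree file constructs at the time of writing — recorded as the residual NV obligation, not claimed.
Nothing here bears on [IUTchIII] Cor. 3.12; typed ≠ proved; a witness certifies consistency only.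
-/

noncomputable section

namespace Literature.AnabelianGeometry.SemiGraphs

namespace ProfiniteSemiGraph

open Literature.AnabelianGeometry.EtaleTheta CategoryTheory Topology
open Literature.GroupTheory.SpecificGroups

universe u w

/-! ### §1. Generic: the trivial outer action -/

section TrivialOuterAction

variable {𝒢 : ProfiniteSemiGraph.{u}} (c : TemperedPiChart 𝒢) (PA : Type w) [Group PA]

/-- The identity representative moves no subgroup. [cite: MochizukiSemiAnbd2006, §0 p.5] -/
theorem map_coe_one_contMulAut (H : Subgroup c.G) :
    H.map ((1 : contMulAut c.G) : MulAut c.G).toMonoidHom = H := by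
  ext x
  constructor
  · rintro ⟨y, hy, rfl⟩
    simpa using hy
  · intro hx
    exact ⟨x, hx, by simp⟩

/-- **`hV` at the trivial outer action** (Prop 3.6 (iv) at `ρ_𝔾(a) = 1`, verticial subgroups): the binder `hV`
of `arithChartAction_outerAction` / `arithChartBranchAction_outerAction` holds for `ρ := 1`, `baseAct := 1`
with the representative `φ := 1`. [cite: MochizukiSemiAnbd2006, Def 5.1 (i) p.62] -/
theorem hV_of_trivialOuterAction :
    ∀ (a : PA) (v : 𝒢.graph.Vertex) (H : Subgroup c.G), H ∈ verticialSubgroups c v →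
      ∃ φ : contMulAut c.G, TopOut.mk c.G φ = (1 : PA →* TopOut c.G) a ∧
        H.map (φ : MulAut c.G).toMonoidHom ∈
          verticialSubgroups c (((1 : PA →* Aut 𝒢.graph) a).hom.vertexMap v) := by
  intro a v H hH
  refine ⟨1, by rw [map_one, MonoidHom.one_apply], ?_⟩
  rw [map_coe_one_contMulAut]
  exact hH

/-- **`hE` at the trivial outer action** (Prop 3.6 (iv) at `ρ_𝔾(a) = 1`, edge-like subgroups).
[cite: MochizukiSemiAnbd2006, Def 5.1 (i) p.62] -/
theorem hE_of_trivialOuterAction :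
    ∀ (a : PA) (e : 𝒢.graph.Edge) (K : Subgroup c.G), K ∈ edgeLikeSubgroups c e →
      ∃ φ : contMulAut c.G, TopOut.mk c.G φ = (1 : PA →* TopOut c.G) a ∧
        K.map (φ : MulAut c.G).toMonoidHom ∈
          edgeLikeSubgroups c (((1 : PA →* Aut 𝒢.graph) a).hom.edgeMap e) := by
  intro a e K hK
  refine ⟨1, by rw [map_one, MonoidHom.one_apply], ?_⟩
  rw [map_coe_one_contMulAut]
  exact hK

/-- **`hopen` at the trivial base action** (Def 5.1 (i)(c)): the open subgroup `⊤ ≤ Π_A` acts trivially on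
vertices, edges and branches. [cite: MochizukiSemiAnbd2006, Def 5.1 (i) p.62] -/
theorem hopen_of_trivialBaseAct [TopologicalSpace PA] :
    ∃ U : Subgroup PA, IsOpen (U : Set PA) ∧ ∀ a ∈ U,
      (∀ v, ((1 : PA →* Aut 𝒢.graph) a).hom.vertexMap v = v) ∧
      (∀ e, ((1 : PA →* Aut 𝒢.graph) a).hom.edgeMap e = e) ∧
        ∀ b, ((1 : PA →* Aut 𝒢.graph) a).hom.branchMap b = b :=
  ⟨⊤, by simp, fun _ _ => ⟨fun _ => rfl, fun _ => rfl, fun _ => rfl⟩⟩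

/-- **`noSwitchBase` at the trivial base action** (Thm 5.4's frame hypothesis «the arithmetic actions on the
underlying graphs … do not switch the branches of any edge»): a trivial action switches nothing.
[cite: MochizukiSemiAnbd2006, Thm 5.4 p.66] -/
theorem noBranchSwitching_of_trivialBaseAct :
    NoBranchSwitching 𝒢.graph.edgeOf
      (fun (a : PA) (b : 𝒢.graph.Branch) => ((1 : PA →* Aut 𝒢.graph) a).hom.branchMap b) :=
  fun _ _ _ => rfl

/-- **`hest` is VACUOUS without edges** (Def 5.3 (ii)): for a semi-graph of anabelioids with no edge, the
produced decomposition data `decompositionDataOfChart R ι` are totally arithmetically estranged for every `ι`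
and every augmentation — there is no edge to test. [cite: MochizukiSemiAnbd2006, Def 5.3 (ii) p.65] -/
theorem isTotallyArithEstranged_decompositionDataOfChart_of_isEmpty [TopologicalSpace PA] [IsEmpty 𝒢.graph.Edge]
    {Gtp : Type*} [Group Gtp] [TopologicalSpace Gtp] (R : ChartRepresentatives c) (ι : c.G →* Gtp)
    (aug : Gtp →* PA) : IsTotallyArithEstranged (decompositionDataOfChart R ι) aug :=
  fun e => isEmptyElim (α := 𝒢.graph.Edge) e

/-- **`hbot` from non-discreteness of `Π_A`**: if `{1}` is not open in `Π_A`, then `⊥` is not arithmetically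
ample for any augmentation `aug : Π → Π_A` (its image is `{1}`). [cite: MochizukiSemiAnbd2006, Def 5.3 (i) p.65] -/
theorem not_isArithAmple_bot_of_not_isOpen_singleton_one [TopologicalSpace PA] {Gtp : Type*} [Group Gtp]
    (h1 : ¬ IsOpen ({1} : Set PA)) (aug : Gtp →* PA) : ¬ IsArithAmple aug (⊥ : Subgroup Gtp) := by
  intro h
  apply h1
  have hcoe : (((⊥ : Subgroup Gtp).map aug : Subgroup PA) : Set PA) = {1} := by
    rw [Subgroup.map_bot, Subgroup.coe_bot]
  rw [← hcoe]
  exact h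

/-- `{1}` is not open in `Aff(ℤ_p)`: every neighbourhood of `1` contains a congruence subgroup `Γ_n`, `n ≥ 1`,
and `Γ_n ∋ (pⁿ, 1) ≠ 1` (abc-iut-w5-d212's `PadicAffine.exists_level_subset`, `transl_mem_level`).
[cite: MochizukiSemiAnbd2006, §0 p.6] -/
theorem not_isOpen_singleton_one_padicAffine (p : ℕ) [Fact p.Prime] :
    ¬ IsOpen ({1} : Set (PadicAffine p)) := by
  intro h
  obtain ⟨n, -, hsub⟩ := PadicAffine.exists_level_subset (p := p) h (Set.mem_singleton 1)
  have hmem : (⟨(p : ℤ_[p]) ^ n, 1⟩ : PadicAffine p) ∈ ({1} : Set (PadicAffine p)) :=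
    hsub (PadicAffine.transl_mem_level (p := p) n)
  have ha := congrArg PadicAffine.a (Set.mem_singleton_iff.mp hmem)
  exact PadicAffine.pow_p_ne_zero (p := p) n ha

end TrivialOuterAction

/-! ### §2. Instance: the one-vertex witness `affWitness p` with `Π_A := Aff(ℤ_p)` and the trivial outer action -/

section AffWitness

variable (p : ℕ) [Fact p.Prime]

/-- The underlying semi-graph of `affWitness p` is (vacuously) a graph: it has no branch.
[cite: MochizukiSemiAnbd2006, §1 p.11] -/
theorem affWitness_isGraph : (affWitness p).graph.IsGraph := ⟨fun b => nomatch b⟩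

/-- **NON-VACUITY of the T54-B capstone's design inputs, all at once**, at the tree's Thm-3.7 witness
`affWitness p` (one vertex `B(Aff(ℤ_p))`, no edge) with chart `affChart p` (`π₁^temp = Aff(ℤ_p)`),
`Π_A := Aff(ℤ_p)`, the trivial outer action `ρ := 1` (so `E = Aff(ℤ_p) ⋊^out Aff(ℤ_p)` with `ι`, `aug` the
structure maps of the outer semi-direct product), `baseAct := 1`, and the representatives `R := ⊤` (the
verticial subgroups of `affChart p` are exactly `{⊤}`): `Thm37Hypotheses`, `IsGraph`, finitely many vertices and
branches, `hV`, `hE`, `hopen`, `noSwitchBase`, `hest`, `hbot` hold simultaneously.  HONEST: `hE`,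
`noSwitchBase`, `hest` are vacuous here (no edge); see the module docstring for the residual contentful NV
obligation. [cite: MochizukiSemiAnbd2006, Thm 5.4 (i) p.66] -/
theorem capstoneDesignInputs_affWitness :
    (affWitness p).Thm37Hypotheses ∧ (affWitness p).graph.IsGraph ∧
    Finite (affWitness p).graph.Vertex ∧ Finite (affWitness p).graph.Branch ∧
    -- hV
    (∀ (a : PadicAffine p) (v : (affWitness p).graph.Vertex) (H : Subgroup (affChart p).G),
      H ∈ verticialSubgroups (affChart p) v →
        ∃ φ : contMulAut (affChart p).G, TopOut.mk (affChart p).G φ =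
            (1 : PadicAffine p →* TopOut (affChart p).G) a ∧
          H.map (φ : MulAut (affChart p).G).toMonoidHom ∈
            verticialSubgroups (affChart p)
              (((1 : PadicAffine p →* Aut (affWitness p).graph) a).hom.vertexMap v)) ∧
    -- hE
    (∀ (a : PadicAffine p) (e : (affWitness p).graph.Edge) (K : Subgroup (affChart p).G),
      K ∈ edgeLikeSubgroups (affChart p) e →
        ∃ φ : contMulAut (affChart p).G, TopOut.mk (affChart p).G φ =
            (1 : PadicAffine p →* TopOut (affChart p).G) a ∧
          K.map (φ : MulAut (affChart p).G).toMonoidHom ∈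
            edgeLikeSubgroups (affChart p)
              (((1 : PadicAffine p →* Aut (affWitness p).graph) a).hom.edgeMap e)) ∧
    -- hopen
    (∃ U : Subgroup (PadicAffine p), IsOpen (U : Set (PadicAffine p)) ∧ ∀ a ∈ U,
      (∀ v, ((1 : PadicAffine p →* Aut (affWitness p).graph) a).hom.vertexMap v = v) ∧
      (∀ e, ((1 : PadicAffine p →* Aut (affWitness p).graph) a).hom.edgeMap e = e) ∧
        ∀ b, ((1 : PadicAffine p →* Aut (affWitness p).graph) a).hom.branchMap b = b) ∧
    -- noSwitchBase
    NoBranchSwitching (affWitness p).graph.edgeOf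
      (fun (a : PadicAffine p) (b : (affWitness p).graph.Branch) =>
        ((1 : PadicAffine p →* Aut (affWitness p).graph) a).hom.branchMap b) ∧
    -- hest (for the representatives `⊤`, whatever topology `E` carries) and hbot
    (∀ [TopologicalSpace (outerSemidirectProduct (1 : PadicAffine p →* TopOut (affChart p).G))],
      ∃ R : ChartRepresentatives (affChart p),
      IsTotallyArithEstranged
        (decompositionDataOfChart R
          (toOuterSemidirectProduct (1 : PadicAffine p →* TopOut (affChart p).G)))
        (outerSemidirectProductSnd (1 : PadicAffine p →* TopOut (affChart p).G))) ∧
    ¬ IsArithAmple (outerSemidirectProductSnd (1 : PadicAffine p →* TopOut (affChart p).G))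
        (⊥ : Subgroup (outerSemidirectProduct (1 : PadicAffine p →* TopOut (affChart p).G))) := by
  haveI : IsEmpty (affWitness p).graph.Edge := ⟨fun e => nomatch e⟩
  refine ⟨affWitness_thm37Hypotheses (p := p), affWitness_isGraph p, ?_, ?_,
    hV_of_trivialOuterAction (affChart p) (PadicAffine p),
    hE_of_trivialOuterAction (affChart p) (PadicAffine p),
    hopen_of_trivialBaseAct (𝒢 := affWitness p) (PadicAffine p),
    noBranchSwitching_of_trivialBaseAct (𝒢 := affWitness p) (PadicAffine p), ?_,
    not_isArithAmple_bot_of_not_isOpen_singleton_one (PadicAffine p)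
      (not_isOpen_singleton_one_padicAffine p) _⟩
  · exact (show Finite PUnit.{1} from inferInstance)
  · exact (show Finite PEmpty.{1} from inferInstance)
  · intro _
    refine ⟨⟨fun _ => ⊤, top_mem_verticialSubgroups_affChart (p := p), (fun b => nomatch b),
      (fun b => nomatch b), (fun b => nomatch b)⟩, ?_⟩
    exact isTotallyArithEstranged_decompositionDataOfChart_of_isEmpty (affChart p) (PadicAffine p) _ _ _

end AffWitness

/-! ### §3 (v2, append-only). The branch-pair design input `hBR` at the trivial outer action

abc-iut-w4-d082's PAIR-LEVEL binder `hBR` of `conj_branchPair_outerAction` / abc-iut-w4-d040's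
`arithChartBranchAction_outerAction` (Prop 3.6 (iv) at `ρ_𝔾(a)` read on (host, branch-group) pairs — the last
DESIGN input of the T54-B binder board «{hV, hE, hopen, hBR}») also holds at `ρ := 1`, `baseAct := 1`: take the
representative `Φ := 1`, the same verticial homomorphism `φ' := φ` and `x' := 1`. -/

section TrivialOuterActionPairs

variable {𝒢 : ProfiniteSemiGraph.{u}} (c : TemperedPiChart 𝒢) (PA : Type w) [Group PA]

/-- Conjugation by `1` moves no subgroup. [cite: MochizukiSemiAnbd2006, §0 p.5] -/
theorem map_conj_one_toMonoidHom (H : Subgroup c.G) : H.map (MulAut.conj (1 : c.G)).toMonoidHom = H := by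
  ext x
  constructor
  · rintro ⟨y, hy, rfl⟩
    simpa using hy
  · intro hx
    exact ⟨x, hx, by simp⟩

/-- **`hBR` at the trivial outer action** (Prop 3.6 (iv) at `ρ_𝔾(a) = 1`, read on (host, branch-group) PAIRS):
the binder `hBR` of `arithChartBranchAction_outerAction` holds for `ρ := 1`, `baseAct := 1` with `Φ := 1`,
`φ' := φ`, `x' := 1` (the branch `a • b = b` abuts to `a • v = v` by the same proof, definitionally).
[cite: MochizukiSemiAnbd2006, Def 5.1 (i) p.62] -/
theorem hBR_of_trivialOuterAction :
    ∀ (a : PA) (b : 𝒢.graph.Branch) (v : 𝒢.graph.Vertex) (hb : 𝒢.graph.abuts b = some v)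
      (φ : 𝒢.Gv v →ₜ* c.G), IsVerticialHom c v φ →
      ∃ Φ : contMulAut c.G, TopOut.mk c.G Φ = (1 : PA →* TopOut c.G) a ∧
        ∃ φ' : 𝒢.Gv (((1 : PA →* Aut 𝒢.graph) a).hom.vertexMap v) →ₜ* c.G,
          IsVerticialHom c (((1 : PA →* Aut 𝒢.graph) a).hom.vertexMap v) φ' ∧ ∃ x' : c.G,
            Subgroup.map (Φ : MulAut c.G).toMonoidHom φ.toMonoidHom.range =
              Subgroup.map (MulAut.conj x').toMonoidHom φ'.toMonoidHom.range ∧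
            Subgroup.map (Φ : MulAut c.G).toMonoidHom
                (Subgroup.map φ.toMonoidHom (𝒢.branchSubgroup b v hb)) =
              Subgroup.map (MulAut.conj x').toMonoidHom
                (Subgroup.map φ'.toMonoidHom
                  (𝒢.branchSubgroup (((1 : PA →* Aut 𝒢.graph) a).hom.branchMap b)
                    (((1 : PA →* Aut 𝒢.graph) a).hom.vertexMap v)
                    (((1 : PA →* Aut 𝒢.graph) a).hom.abuts_branchMap b v hb))) := by
  intro a b v hb φ hφ
  refine ⟨1, by rw [map_one, MonoidHom.one_apply], φ, hφ, 1, ?_, ?_⟩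
  · rw [map_coe_one_contMulAut, map_conj_one_toMonoidHom]
    exact rfl
  · rw [map_coe_one_contMulAut, map_conj_one_toMonoidHom]
    exact rfl

end TrivialOuterActionPairs

end ProfiniteSemiGraph

end Literature.AnabelianGeometry.SemiGraphs

end
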